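import Literature.NumberTheory.EllipticCurves.PAdicLFunctionMinus
import HarnessLib

/-!
# The MINUS Mazur–Tate–Teitelbaum measure at a prime `p ∣ N` (`ε(p) = 0`: ONE term) and its
# `ω^i`-branches `L⁻_p(f, α, ω^i, T)` — the odd branches of `L_p(E)` at a prime of MULTIPLICATIVE reduction

Topic `NumberTheory/EllipticCurves`; namespace `Literature.NumberTheory.EllipticCurves`. DEFINITIONS
only (plus two unfolding `simp` lemmas and the value on `ℤ_p`); nothing asserted, no named fact
(D-0026). Companion of `PAdicLFunctionMinus` (`msdMinusMeasure f α` = the TWO-term minus measure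
(10.1) at a prime `p ∤ N`, `padicLFunctionMinusBranch f α i` its branches) and of
`PAdicLFunctionMultiplicativeInterpolation` (`IsMultPAdicLFunctionOf f p α L`, the interpolation
package of the EVEN branch `ω⁰` at a prime `p ∣ N`).

**The point.** Mazur–Tate–Teitelbaum 1986, Ch. I §10, (10.1): for an eigenform `f` of level `N`,
character `ε`, and an allowable `p`-root `α` (a root of `X² − a_p X + ε(p)p`), the `p`-adic
distribution is `μ_{f,α}(a + pⁿℤ_p) = α⁻ⁿ [a/pⁿ] − ε(p) α⁻⁽ⁿ⁺¹⁾ [a/pⁿ⁻¹]`, where `ε(p) = 0` when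
`p ∣ N`. So at a prime `p ∣ N` (for the newform of an elliptic curve: a prime of bad reduction; the
only allowable root is `α = a_p`, non-zero exactly when the reduction is MULTIPLICATIVE, `a_p = ±1`)
the measure has ONE term, `μ_{f,α}(a + pⁿℤ_p) = α⁻ⁿ [a/pⁿ]`, and its distribution property is the
`U_p`-relation `a_p [r] = ∑_{j mod p} [(r + j)/p]` (MTT §I.4 (4.2) with `ε(p) = 0`; tree THEOREM
`cuspCoeff_mul_modularSymbol_of_dvd`). The tree's two-term objects `msdMeasure` / `msdMinusMeasure`
(built with `ε(p) = 1`) are NOT distributions at such `p`; the even branch at `p ∣ N` is carried in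
the tree by the predicate `IsMultPAdicLFunctionOf` (existence: `exists_isMultPAdicLFunctionOf_neg_one_of_nonsplit`,
x11c). This file supplies the ODD side at `p ∣ N`, symbol for symbol the formulas of
`PAdicLFunctionMinus` with the one-term measure:

* `msdMinusMeasureMult f α n a = α⁻ⁿ [a/pⁿ]⁻_f` (`[·]⁻ = ratMinusSymbol f`, cast `ℚ → ℚ_p`);
  `msdMinusMeasureMult_zero`: `μ⁻(ℤ_p) = [0]⁻ = 0`.
* `padicLMinusBranchMultRiemannSum / padicLMinusBranchMultCoeff / padicLFunctionMinusBranchMult f α i`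
  — the `ω^i`-branches `∫_{ℤ_p^×} ω^i(x) (1+T)^{ℓ(x)} dμ⁻_{f,α}(x) ∈ ℚ_p⟦T⟧` of this measure (Riemann
  sums over `ζ γˢ + p^{n+e₀}ℤ_p`, `ζ` Teichmüller, `γ = cyclotomicGenerator p`, limit, power series),
  literally `padicLMinusBranchRiemannSum / …Coeff / padicLFunctionMinusBranch` with `μ⁻_mult` for `μ⁻`.
  For ODD `i` and `α = a_p = ±1` these are the odd tame branches `L_p(E, ω^i, T)` of the `p`-adic
  `L`-function of an elliptic curve `E` with multiplicative reduction at `p` (MTT §I.13; normalised by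
  `Ω⁻_f`); at `p = 3`, `i = 1` this is the `e₋`-component of Wuthrich's `L_p(E) ∈ ℤ₃⟦ℤ₃^×⟧`
  (Doc. Math. 19 (2014), Cor. 18: "`L_p(E)` belongs to `Λ` for all elliptic curves `E/ℚ` with
  semi-stable reduction at `p > 2`").

NOT here (theorems, sibling file `PAdicLFunctionMinusMultDistributionProofs`): the `U_p`-relation for
`[·]⁻`, the distribution law of `μ⁻_mult`, and the constant term
`L⁻_p(f, a_p, ω^i, 0) = ∑_{a ∈ (ℤ/p^{e₀})ˣ} μ⁻(a) ω(a)^i` (`= a_p⁻¹ ∑_{a mod p} (a/p) [a/p]⁻_f` for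
`i = (p−1)/2` odd).

Motivation (BSD rank-`≤ 1` residual cell `b2b-bsdres`, HOME `run/shared/lean/b2b/bsd-rank1-residual/`,
sub-cell additive-p4, line V15 = the (M)-rows of X3/X4 at `p = 3`: `W ≅ V^{(−3)}` additive at `3` with
`V` NON-SPLIT multiplicative at `3`, 228 CORE-open rank-(0,0) pairs `N < 2·10⁴`): Wuthrich's Thm. 16 /
Cor. 19 for `V` over `ℚ(ζ_{3^∞}) = ℚ(ζ₃)_∞` involve both tame branches of `L₃(V)`; the odd one at a
multiplicative prime had no name in the tree. HONEST FRAMING: vocabulary only; no label changes.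

## References
* B. Mazur, J. Tate, J. Teitelbaum, *On `p`-adic analogues of the conjectures of Birch and
  Swinnerton-Dyer*, Invent. Math. 84 (1986) 1–48: Ch. I §4 (4.2), §8, §10 (10.1) (`ε(p) = 0` for
  `p ∣ N`), §13 (branches), §14. [MazurTateTeitelbaum1986Invent]
* R. Greenberg, *Iwasawa theory for elliptic curves*, LNM 1716 (1999), §4 (PDF p. 112–113): "One should
  take `α_v = −1`, `β_v = 0`" at a non-split multiplicative prime. [GreenbergLNM1716]
* C. Wuthrich, Doc. Math. 19 (2014) 381–402, Cor. 18. [Wuthrich2014]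
-/

noncomputable section

open scoped MatrixGroups ModularForm

open CongruenceSubgroup Filter Topology Literature.NumberTheory.EllipticCurves.ModularForms

namespace Literature.NumberTheory.EllipticCurves

section Measure

variable {N : ℕ} (f : CuspForm (Gamma0 N) 2) {p : ℕ} [Fact p.Prime]

/-- The **minus Mazur–Tate–Teitelbaum measure at a prime `p ∣ N`** (`ε(p) = 0`, ONE term):
`μ⁻_{f,α}(a + pⁿℤ_p) = α⁻ⁿ [a/pⁿ]⁻_f` on the compact opens `a + pⁿℤ_p` (`a : ZMod (p ^ n)`,
represented by `a.val`; any representative gives the same value by `ratMinusSymbol_add_intCast`),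
with the minus symbol `[·]⁻ = ratMinusSymbol f` cast `ℚ → ℚ_p` — formula (10.1) of
Mazur–Tate–Teitelbaum 1986 §I.10 in the case `ε(p) = 0`, for the allowable root `α` (`= a_p(f)` for
the newform of an elliptic curve with multiplicative reduction at `p`). One-term twin of
`msdMinusMeasure` (the case `ε(p) = 1`, `p ∤ N`). Junk (harmless) for `α = 0`.
[cite: MazurTateTeitelbaum1986Invent, §I.10 (10.1) with ε(p) = 0] -/
def msdMinusMeasureMult (α : ℚ_[p]) (n : ℕ) (a : ZMod (p ^ n)) : ℚ_[p] :=
  α⁻¹ ^ n * (ratMinusSymbol f ((a.val : ℚ) / (p : ℚ) ^ n) : ℚ_[p])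

/-- `μ⁻_{f,α}(ℤ_p) = [0]⁻_f = 0` for the one-term minus measure (level `n = 0`: `ZMod (p⁰)` is a
singleton, the representative is `0`, and `[0]⁻ = 0`).
[cite: MazurTateTeitelbaum1986Invent, §I.10 (10.1) with ε(p) = 0] -/
theorem msdMinusMeasureMult_zero (α : ℚ_[p]) (a : ZMod (p ^ 0)) :
    msdMinusMeasureMult f α 0 a = 0 := by
  haveI : Subsingleton (ZMod (p ^ 0)) := (ZMod.subsingleton_iff).mpr (pow_zero p)
  rw [Subsingleton.elim a 0]
  simp [msdMinusMeasureMult, ratMinusSymbol_zero]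

/-- The `n`-th **Riemann sum** for the `k`-th coefficient of the `ω^i`-branch of the one-term minus
measure at `p ∣ N`: `∑_ζ ζ^i ∑_{s mod pⁿ} μ⁻_{f,α}(ζ γˢ + p^{n+e₀}ℤ_p) · (s choose k)` (`ζ` over the
Teichmüller representatives = torsion of `ℤ_p^×`, `γ = cyclotomicGenerator p`, `e₀ = cyclotomicExponent p`)
— literally `padicLMinusBranchRiemannSum` with `msdMinusMeasureMult` for `msdMinusMeasure`.
[cite: MazurTateTeitelbaum1986Invent, §I.13] -/
def padicLMinusBranchMultRiemannSum (α : ℚ_[p]) (i k n : ℕ) : ℚ_[p] :=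
  ∑ᶠ ζ : rootsOfUnity (torsionOrder p) ℤ_[p], ∑ s : ZMod (p ^ n),
    ((((ζ : ℤ_[p]ˣ) : ℤ_[p]) : ℚ_[p]) ^ i *
      msdMinusMeasureMult f α (n + cyclotomicExponent p)
          (PadicInt.toZModPow (n + cyclotomicExponent p) ((ζ : ℤ_[p]ˣ) : ℤ_[p]) *
            (cyclotomicGenerator p : ZMod (p ^ (n + cyclotomicExponent p))) ^ s.val) *
        (s.val.choose k : ℚ_[p]))

/-- The `k`-th **coefficient of the `ω^i`-branch** of the one-term minus measure at `p ∣ N`: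
`∫_{ℤ_p^×} ω^i(x) (ℓ(x) choose k) dμ⁻_{f,α}(x) = lim_n padicLMinusBranchMultRiemannSum f α i k n`
(junk value of `limUnder` if the limit does not exist, as for `padicLMinusBranchCoeff`).
[cite: MazurTateTeitelbaum1986Invent, §I.11–I.13] -/
def padicLMinusBranchMultCoeff (α : ℚ_[p]) (i k : ℕ) : ℚ_[p] :=
  limUnder atTop (padicLMinusBranchMultRiemannSum f α i k)

/-- The **`ω^i`-branch of the `p`-adic `L`-function at a prime `p ∣ N`, built on the one-term MINUS
measure**: `L⁻_p(f, α, ω^i, T) = ∫_{ℤ_p^×} ω^i(x) (1 + T)^{ℓ(x)} dμ⁻_{f,α}(x) ∈ ℚ_p⟦T⟧`. For ODD `i`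
and `α = a_p(f) = ±1` (the newform of an elliptic curve `E/ℚ` with multiplicative reduction at `p`)
this is the odd tame branch `L_p(E, ω^i, T)` of Mazur–Tate–Teitelbaum §I.13 normalised by `Ω⁻_f`
(special values `τ(ω^iκ) L(f, ω^{−i}κ̄, 1)/Ω⁻_f` up to the usual factors, §I.14 with `ε(p) = 0`: no
Euler-type factor at conductor-`p^m` characters). Twin of `padicLFunctionMinusBranch` (`p ∤ N`).
[cite: MazurTateTeitelbaum1986Invent, §I.13] -/
def padicLFunctionMinusBranchMult (α : ℚ_[p]) (i : ℕ) : PowerSeries ℚ_[p] :=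
  PowerSeries.mk (padicLMinusBranchMultCoeff f α i)

/-- The `k`-th coefficient of `L⁻_p(f, α, ω^i, T)` at `p ∣ N` is `padicLMinusBranchMultCoeff f α i k`
(unfolding; MTT §I.13). [cite: MazurTateTeitelbaum1986Invent, §I.13] -/
@[simp] theorem coeff_padicLFunctionMinusBranchMult (α : ℚ_[p]) (i k : ℕ) :
    PowerSeries.coeff k (padicLFunctionMinusBranchMult f α i) = padicLMinusBranchMultCoeff f α i k :=
  PowerSeries.coeff_mk _ _

/-- The constant term of `L⁻_p(f, α, ω^i, T)` at `p ∣ N` is `padicLMinusBranchMultCoeff f α i 0 =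
∫ ω^i dμ⁻_{f,α}` (unfolding; MTT §I.13). [cite: MazurTateTeitelbaum1986Invent, §I.13] -/
@[simp] theorem constantCoeff_padicLFunctionMinusBranchMult (α : ℚ_[p]) (i : ℕ) :
    PowerSeries.constantCoeff (padicLFunctionMinusBranchMult f α i) =
      padicLMinusBranchMultCoeff f α i 0 :=
  PowerSeries.constantCoeff_mk

end Measure

end Literature.NumberTheory.EllipticCurves

end
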